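import Summits.CriticalPhenomena.CardyFormulaZ2.Theses.CardySelfRefinement
import Summits.CriticalPhenomena.CardyFormulaZ2.Theses.CardyRotToConf
import Summits.CriticalPhenomena.CardyFormulaZ2.Theorems.CardySelfRefinementLagHandOffDiscretisable
import Literature.Probability.Percolation.BondInterfaceMeasurability
import HarnessLib

/-!
# `SymmetryUpgradeR` (route CardySelfRefinement, stmt-CriticalPhenomena-17239) ↔
# `CardyRotToConfR2SymmetryUpgradeR` (route CardyRotToConf, stmt-CriticalPhenomena-17237)

Pure-logic glue recorded by both grounders of the two repaired symmetry-upgrade cruxes (2026-08-16): the typed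
statements differ only by

* (a) 17237's antecedent `∀ D₀, ∃ E₀, ZdDiscretisationFamily D₀ E₀` — a tree theorem,
  `Cruxes.LagHandOff.HittingTournament.stub_discretisable`
  (`Theorems/CardySelfRefinementLagHandOffDiscretisable.lean`);
* (b) 17239's extra hypothesis (iii) "interfaces eventually a.e.-measurable" — discharged for every `D`, `E`, `δ`
  and every measure by `Literature.Probability.Percolation.measurable_bondInterfaceIn`;
* (c) 17239 concludes `IsSLELaw 6 D (P D)` only for `D` carrying an admissible discretisation family, 17237 for
  all `D` — the same by (a).

Hence the two cruxes are ONE open problem: `symmetryUpgradeR_iff_cardyRotToConfR2SymmetryUpgradeR`.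
-/

namespace Summit.CriticalPhenomena.CardyFormulaZ2.Theorems

open Literature.Probability.Percolation Literature.Probability.RandomPlanarGeometry
open Summit.CriticalPhenomena.CardyFormulaZ2.Cruxes.LagHandOff.HittingTournament (stub_discretisable)

/-- `CardyRotToConfR2SymmetryUpgradeR → SymmetryUpgradeR`: feed the discretisability antecedent with the tree
theorem `stub_discretisable`, drop hypothesis (iii), and specialise the conclusion to the given domain. -/
theorem symmetryUpgradeR_of_cardyRotToConfR2SymmetryUpgradeR :
    Theses.CardyRotToConf.CardyRotToConfR2SymmetryUpgradeR → Theses.CardySelfRefinement.SymmetryUpgradeR := by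
  intro h P hP hnt _hmeas hconv D _E _hE
  exact h stub_discretisable P hP hnt hconv D

/-- `SymmetryUpgradeR → CardyRotToConfR2SymmetryUpgradeR`: hypothesis (iii) holds for every `D`, `E`, `δ`
(`measurable_bondInterfaceIn`), and the antecedent supplies, for the given `D`, an admissible family `E` at which
`SymmetryUpgradeR` delivers `IsSLELaw 6 D (P D)`. -/
theorem cardyRotToConfR2SymmetryUpgradeR_of_symmetryUpgradeR :
    Theses.CardySelfRefinement.SymmetryUpgradeR → Theses.CardyRotToConf.CardyRotToConfR2SymmetryUpgradeR := by
  intro h hdisc P hP hnt hconv D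
  obtain ⟨E, hE⟩ := hdisc D
  exact h P hP hnt (fun D' E' _ => Filter.Eventually.of_forall fun δ =>
    (measurable_bondInterfaceIn D' (E' δ)).aemeasurable) hconv D E hE

/-- **The two repaired symmetry-upgrade cruxes are equivalent**: `CardySelfRefinement.SymmetryUpgradeR`
(stmt-CriticalPhenomena-17239) `↔` `CardyRotToConf.CardyRotToConfR2SymmetryUpgradeR`
(stmt-CriticalPhenomena-17237). -/
theorem symmetryUpgradeR_iff_cardyRotToConfR2SymmetryUpgradeR : Summit.CriticalPhenomena.CardyFormulaZ2.Theses.CardySelfRefinement.SymmetryUpgradeR ↔ Summit.CriticalPhenomena.CardyFormulaZ2.Theses.CardyRotToConf.CardyRotToConfR2SymmetryUpgradeR :=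
  ⟨cardyRotToConfR2SymmetryUpgradeR_of_symmetryUpgradeR, symmetryUpgradeR_of_cardyRotToConfR2SymmetryUpgradeR⟩

end Summit.CriticalPhenomena.CardyFormulaZ2.Theorems
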